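import Summits.Langlands.Langlands.Theses.ParityBlindBianchi
import Summits.Langlands.Langlands.Theorems.ParityBlindBianchiTwoAdicBianchiProModularityLevelStubUniformizer
import Literature.NumberTheory.Automorphic.RegularAlgebraicCuspidalHeckePointProofs
import HarnessLib

/-!
# The degenerate branch `0 ∈ S₀` of the crux `TwoAdicBianchiProModularityLevel` (stmt-Langlands-15110)

Route `ParityBlindBianchi` of summit `Langlands`, crux E2′ `TwoAdicBianchiProModularityLevel`
(line `Sketch`, lead c7).  The crux quantifies over every finite set `S₀ ∋ 2` of "bad rational
primes" (`S₀ : Finset ℕ`, not required to consist of primes); its good places are the finite places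
`v` of `K` with `(ℓ : 𝓞 K) ∉ v` for all `ℓ ∈ S₀`.  When `0 ∈ S₀` there is NO good place
(`(0 : 𝓞 K) ∈ v` for every `v`), so the index type of the Hecke family is empty, the association
clause is vacuous, the tame-level clause only asks `U ∋ g` for integral `g`, and the `IsHeckePoint`
clause holds for `U = GL₂(𝒪̂_K)` by `isHeckePoint_of_isEmpty` (`2` is not a unit of `𝒪_{ℚ̄₂}`;
the empty Hecke algebra is the closure of the scalars, which still has the `𝒪/2^t`-points read off
a constant function in `H⁰`).  Hence the crux restricted to `0 ∈ S₀` is a theorem of the tree: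
`TwoAdicBianchiProModularityLevel_of_zero_mem` below (the crux's signature verbatim with the extra
binder `(0 : ℕ) ∈ S₀`).  This is bookkeeping — the content of E2′ is the case `0 ∉ S₀` (big `R = 𝕋`
for `GL₂/K` at `p = 2` read at the Artin point, the registered stub `stub_artinLift`) — but it closes
the one branch of the `∀ S₀` that the refuter's degenerate-parameter finding (DegenerateS0.lean,
rattack-15110) singled out, unconditionally and without the residual-automorphy hypothesis.
-/

noncomputable section

set_option linter.dupNamespace false -- `Summit.Langlands.Langlands` is the mandated namespace (D-0017)

open scoped NumberField MatrixGroups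
open IsDedekindDomain
open Literature.NumberTheory.GaloisRepresentations Literature.NumberTheory.Automorphic

namespace Summit.Langlands.Langlands.Theorems.TwoAdicBianchiProModularityLevel

/-- If `0 ∈ S₀` no finite place of `K` is good: `((0 : ℕ) : 𝓞 K) = 0` lies in every prime.
[folklore] -/
theorem not_good_of_zero_mem {K : Type} [Field K] [NumberField K] {S₀ : Finset ℕ}
    (h0 : (0 : ℕ) ∈ S₀) (v : HeightOneSpectrum (𝓞 K)) :
    ¬ (∀ ℓ ∈ S₀, ((ℓ : ℕ) : 𝓞 K) ∉ v.asIdeal) := fun hv =>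
  hv 0 h0 (by rw [Nat.cast_zero]; exact Ideal.zero_mem _)

/-- **The degenerate branch `0 ∈ S₀` of the crux E2′ `TwoAdicBianchiProModularityLevel`** — the
crux's signature verbatim with the extra hypothesis `(0 : ℕ) ∈ S₀`, proved unconditionally (and
without using the residual-automorphy hypothesis): there are no good places, so take
`U = GL₂(𝒪̂_K)`, any uniformisers (`stub_uniformizer`), the zero eigenvalue family on the empty
index type, `IsHeckePoint` by `isHeckePoint_of_isEmpty` (`2 ∉ 𝒪_{ℚ̄₂}ˣ`), and the association
clause vacuously. [folklore] -/
theorem TwoAdicBianchiProModularityLevel_of_zero_mem :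
    ∀ (K : Type) [Field K] [NumberField K], NumberField.IsTotallyComplex K → Module.finrank ℚ K = 2 →
    (∃ v w : IsDedekindDomain.HeightOneSpectrum (NumberField.RingOfIntegers K), v ≠ w ∧
      ((2 : ℕ) : NumberField.RingOfIntegers K) ∈ v.asIdeal ∧
      ((2 : ℕ) : NumberField.RingOfIntegers K) ∈ w.asIdeal) →
    ∀ (ι : PadicAlgCl 2 ≃+* ℂ)
      (σ : Literature.NumberTheory.GaloisRepresentations.FramedGaloisRep K (PadicAlgCl 2) 2),
    Finite σ.toMonoidHom.range → σ.toGaloisRep.IsIrreducible →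
    Nonempty ((Matrix.ProjGenLinGroup.mk.comp σ.toMonoidHom).range ≃* alternatingGroup (Fin 5)) →
    ∀ S₀ : Finset ℕ, 2 ∈ S₀ → (0 : ℕ) ∈ S₀ →
    (∃ (hcpt : Literature.NumberTheory.Automorphic.isCompact_glFiniteIntegralLevel 2 K)
        (π₀ : Literature.NumberTheory.Automorphic.CuspidalAutomorphicRepData 2 K hcpt),
      π₀.1.IsRegularAlgebraic ∧
      ∀ v : IsDedekindDomain.HeightOneSpectrum (NumberField.RingOfIntegers K),
        (∀ ℓ ∈ S₀, ((ℓ : ℕ) : NumberField.RingOfIntegers K) ∉ v.asIdeal) →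
        ∃ (α : Multiset ℂ) (P : Polynomial (PadicAlgCl 2)), π₀.1.HasSatakeParamAt v α ∧
          σ.IsUnramifiedAt v ∧ σ.HasFrobCharpolyAt v P ∧
          ∀ i : ℕ, ‖P.coeff i - (Literature.NumberTheory.Automorphic.arithFrobPolyOfSatake ι
            v.residueCard 2 α).coeff i‖ < 1) →
    ∃ (U : Subgroup (GL (Fin 2) (IsDedekindDomain.FiniteAdeleRing (NumberField.RingOfIntegers K) K)))
      (ϖ : ∀ v : IsDedekindDomain.HeightOneSpectrum (NumberField.RingOfIntegers K),
        (v.adicCompletion K)ˣ)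
      (a : {v : IsDedekindDomain.HeightOneSpectrum (NumberField.RingOfIntegers K) //
          ∀ ℓ ∈ S₀, ((ℓ : ℕ) : NumberField.RingOfIntegers K) ∉ v.asIdeal} → ℕ →
        (Valued.v (R := PadicAlgCl 2)).valuationSubring),
      IsOpen (U : Set (GL (Fin 2) (IsDedekindDomain.FiniteAdeleRing (NumberField.RingOfIntegers K) K))) ∧
      U ≤ Literature.NumberTheory.Automorphic.glFiniteIntegralLevel 2 K ∧
      (∀ g ∈ Literature.NumberTheory.Automorphic.glFiniteIntegralLevel 2 K,
        (∀ v : IsDedekindDomain.HeightOneSpectrum (NumberField.RingOfIntegers K),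
          ¬ (∀ ℓ ∈ S₀, ((ℓ : ℕ) : NumberField.RingOfIntegers K) ∉ v.asIdeal) →
          ∀ i j : Fin 2, ((g : Matrix (Fin 2) (Fin 2)
            (IsDedekindDomain.FiniteAdeleRing (NumberField.RingOfIntegers K) K)) i j) v =
            (1 : Matrix (Fin 2) (Fin 2) (v.adicCompletion K)) i j) → g ∈ U) ∧
      (∀ v : IsDedekindDomain.HeightOneSpectrum (NumberField.RingOfIntegers K),
        Valued.v ((ϖ v : (v.adicCompletion K)ˣ) : v.adicCompletion K) = WithZero.exp (-1 : ℤ)) ∧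
      Literature.NumberTheory.Automorphic.IsHeckePoint
        (Matrix.GeneralLinearGroup.map (n := Fin 2)
          (algebraMap K (IsDedekindDomain.FiniteAdeleRing (NumberField.RingOfIntegers K) K)))
        (Literature.NumberTheory.Automorphic.LevelTower.ofSeq U (fun r : ℕ =>
          (Literature.NumberTheory.Automorphic.principalCongruenceLevel 2 K
            (Ideal.span {((2 : ℕ) : NumberField.RingOfIntegers K)} ^ r)).map
            (Literature.NumberTheory.Automorphic.GLn.sndHom 2 K)))
        ((2 : ℕ) : (Valued.v (R := PadicAlgCl 2)).valuationSubring)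
        (fun j : {v : IsDedekindDomain.HeightOneSpectrum (NumberField.RingOfIntegers K) //
            ∀ ℓ ∈ S₀, ((ℓ : ℕ) : NumberField.RingOfIntegers K) ∉ v.asIdeal} × Fin 2 =>
          Literature.NumberTheory.Automorphic.GLn.sndHom 2 K
            (Literature.NumberTheory.Automorphic.heckeDiagAt 2 K j.1.1 (ϖ j.1.1) (j.2.val + 1)))
        (fun j => a j.1 (j.2.val + 1)) ∧
      ∀ (v : IsDedekindDomain.HeightOneSpectrum (NumberField.RingOfIntegers K))
        (hv : ∀ ℓ ∈ S₀, ((ℓ : ℕ) : NumberField.RingOfIntegers K) ∉ v.asIdeal),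
        σ.IsHeckeAssociatedAt v (fun i : ℕ => if i = 0 then (1 : PadicAlgCl 2) else
          ((a ⟨v, hv⟩ i : (Valued.v (R := PadicAlgCl 2)).valuationSubring) : PadicAlgCl 2)) := by
  intro K _ _ _ _ _ ι σ _ _ _ S₀ _ h0 _
  haveI : IsEmpty {v : IsDedekindDomain.HeightOneSpectrum (NumberField.RingOfIntegers K) //
      ∀ ℓ ∈ S₀, ((ℓ : ℕ) : NumberField.RingOfIntegers K) ∉ v.asIdeal} :=
    ⟨fun v => not_good_of_zero_mem h0 v.1 v.2⟩
  choose ϖ hϖ using stub_uniformizer K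
  haveI : Fact (Nat.Prime 2) := ⟨Nat.prime_two⟩
  refine ⟨Literature.NumberTheory.Automorphic.glFiniteIntegralLevel 2 K, ϖ, fun _ _ => 0,
    Literature.NumberTheory.Automorphic.isOpen_glFiniteIntegralLevel 2 K, le_rfl,
    fun g hg _ => hg, hϖ, ?_, fun v hv => (not_good_of_zero_mem h0 v hv).elim⟩
  exact isHeckePoint_of_isEmpty (not_isUnit_natCast_valuationSubring_padicAlgCl 2)

end Summit.Langlands.Langlands.Theorems.TwoAdicBianchiProModularityLevel

end
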